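import Summits.RiemannHypothesis.RiemannHypothesis.Theorems.PfPersistenceAlignedClass

/-!
# PF persistence — the aligned class vs the harness READER, and alignment ⟸ the M2 variational ratio
(pub-rhpf CAND SEAT 1 gen 3, `planner-pub-rhpf-cand-1-g3-0`)

**HONEST FRAMING. This is a long-odds MECHANISM SEARCH; no RH claims.** Labels PROVED / TYPED / DATA as in
`PfPersistenceAdmissibleClass.lean` / `PfPersistenceGapClassG1.lean` / `PfPersistenceAlignedClass.lean`. Nothing in this
file bears on RH: it is finite-dimensional linear algebra about ONE real symmetric matrix with a simple ground state.

`PfPersistenceAlignedClass.lean` certified the CLASS `alignedClassOn R g δ₀` (eigenvector-free: 'no `δ₀`-misaligned unit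
vector is a ground state') as a G1-cont member. The harness reader GUESS-ALIGN (`cand1-001`; GAP-CLASSES rows C1-I1, C1-CERT)
computes something else: the defect `1 − |⟨u₁, k̂⟩|` of THE served ground vector `u₁`. This file closes the gap between the
two and records the elementary inequality behind GAP-CLASSES row C1-N2:

* §1 `GroundGap M u ε₁ ε₂`: `M` symmetric, `u` a unit eigenvector with eigenvalue `ε₁`, and the form bounded below by
  `ε₂ > ε₁` on `u^⊥` (a simple ground state with a spectral gap — the served situation at every window of record).
  PROVED `GroundGap.rayleigh_eq` (`wᵀMw = ⟨w,u⟩²·ε₁ + rᵀMr`, `r = w − ⟨w,u⟩u`) and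
  **`GroundGap.defect_mul_gap_le`: `(1 − ⟨w,u⟩²)(ε₂ − ε₁) ≤ wᵀMw − ε₁`** for every unit `w` — 'alignment ⟸ variational
  ratio': the squared-sine defect of ANY unit vector against the ground state is at most its M2 ratio
  `(R(w) − ε₁)/(ε₂ − ε₁)` (row C1-N2; on `ζ` the DATA say the inequality is saturated to a factor `1.4–6.5`).
* §2 PROVED `GroundGap.isGround` (`u` minimises the Rayleigh quotient), `GroundGap.rayleigh_gt` (strictly, off `±u`),
  `GroundGap.eq_smul_of_sq_eq_one` (`⟨w,u⟩² = 1 ⇒ w = ⟨w,u⟩u`).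
* §3 **READER = CLASS.** PROVED `GroundGap.windowAligned_iff`: under a ground gap, `WindowAligned g δ₀ M ↔
  alignDefect u g < δ₀` — membership of a window matrix in the aligned class IS the reader's verdict on the served ground
  vector; hence `mem_alignedClassOn_iff_of_groundGap` for data with a ground gap at every window of the regime. So the
  (I)-column certificate `inG1cont_alignedClassOn` applies to GUESS-ALIGN exactly as implemented (up to `<` vs `≤` at the
  threshold), and `alignDefect_mul_gap_le` bounds the reader's defect by the M2 ratio of the guess.

What is NOT here: any statement about `zetaDatum` (whether ζ's windows have a ground gap, or are aligned, is DATA of the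
atlas, never asserted in the kernel), Connes' guess `k̂` itself (a definition request), or anything of RH-strength.
-/

set_option linter.dupNamespace false  -- the mandated namespace repeats `RiemannHypothesis`

open Real Finset Matrix

namespace Summit.RiemannHypothesis.RiemannHypothesis.Theorems.PfPersistence

/-! ## §1 A simple ground state with a spectral gap; the M2 inequality -/

/-- GROUND GAP at a window: `M` is symmetric, `u` is a Euclidean-unit eigenvector with eigenvalue `ε₁`, and on the
orthogonal complement of `u` the form is bounded below by `ε₂ > ε₁` (so `ε₁` is the simple bottom eigenvalue and `ε₂` a
lower bound for the rest of the spectrum). [folklore] -/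
structure GroundGap {n : ℕ} (M : Matrix (Fin n) (Fin n) ℝ) (u : Fin n → ℝ) (ε₁ ε₂ : ℝ) : Prop where
  symm : Mᵀ = M
  unit : u ⬝ᵥ u = 1
  eig : M *ᵥ u = ε₁ • u
  gap : ∀ w : Fin n → ℝ, w ⬝ᵥ u = 0 → ε₂ * (w ⬝ᵥ w) ≤ w ⬝ᵥ (M *ᵥ w)
  lt : ε₁ < ε₂

/-- the form of a symmetric matrix is symmetric: `wᵀ(Mv) = vᵀ(Mw)`. [folklore] -/
theorem dotProduct_mulVec_comm_of_transpose_eq {n : ℕ} {M : Matrix (Fin n) (Fin n) ℝ} (hM : Mᵀ = M)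
    (v w : Fin n → ℝ) : w ⬝ᵥ (M *ᵥ v) = v ⬝ᵥ (M *ᵥ w) := by
  have h : w ᵥ* M = M *ᵥ w := by rw [← Matrix.vecMul_transpose, hM]
  rw [Matrix.dotProduct_mulVec, h, dotProduct_comm]

namespace GroundGap

variable {n : ℕ} {M : Matrix (Fin n) (Fin n) ℝ} {u : Fin n → ℝ} {ε₁ ε₂ : ℝ}

/-- the ground Rayleigh value is `ε₁`. [folklore] -/
theorem rayleigh_ground (h : GroundGap M u ε₁ ε₂) : u ⬝ᵥ (M *ᵥ u) = ε₁ := by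
  rw [h.eig, dotProduct_smul, smul_eq_mul, h.unit, mul_one]

/-- the residual `r = w − ⟨w,u⟩u` is orthogonal to `u`. [folklore] -/
theorem residual_dotProduct (h : GroundGap M u ε₁ ε₂) (w : Fin n → ℝ) : (w - (w ⬝ᵥ u) • u) ⬝ᵥ u = 0 := by
  rw [sub_dotProduct, smul_dotProduct, smul_eq_mul, h.unit, mul_one, sub_self]

/-- `‖r‖² = 1 − ⟨w,u⟩²` for unit `w`. [folklore] -/
theorem residual_normSq (h : GroundGap M u ε₁ ε₂) {w : Fin n → ℝ} (hw : w ⬝ᵥ w = 1) :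
    (w - (w ⬝ᵥ u) • u) ⬝ᵥ (w - (w ⬝ᵥ u) • u) = 1 - (w ⬝ᵥ u) ^ 2 := by
  have hu := h.unit
  have hc : u ⬝ᵥ w = w ⬝ᵥ u := dotProduct_comm u w
  simp only [dotProduct_sub, sub_dotProduct, dotProduct_smul, smul_dotProduct, smul_eq_mul, hw, hu, hc]
  ring

/-- PROVED (Rayleigh decomposition along the ground state): `wᵀMw = ⟨w,u⟩²·ε₁ + rᵀMr`. [folklore] -/
theorem rayleigh_eq (h : GroundGap M u ε₁ ε₂) (w : Fin n → ℝ) :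
    w ⬝ᵥ (M *ᵥ w) = (w ⬝ᵥ u) ^ 2 * ε₁ + (w - (w ⬝ᵥ u) • u) ⬝ᵥ (M *ᵥ (w - (w ⬝ᵥ u) • u)) := by
  have e1 : (w - (w ⬝ᵥ u) • u) ⬝ᵥ (M *ᵥ (w - (w ⬝ᵥ u) • u)) =
      w ⬝ᵥ (M *ᵥ w) - (w ⬝ᵥ u) * (w ⬝ᵥ (M *ᵥ u)) - (w ⬝ᵥ u) * (u ⬝ᵥ (M *ᵥ w))
        + (w ⬝ᵥ u) * (w ⬝ᵥ u) * (u ⬝ᵥ (M *ᵥ u)) := by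
    simp only [Matrix.mulVec_sub, Matrix.mulVec_smul, dotProduct_sub, sub_dotProduct, dotProduct_smul,
      smul_dotProduct, smul_eq_mul]
    ring
  have e2 : w ⬝ᵥ (M *ᵥ u) = ε₁ * (w ⬝ᵥ u) := by rw [h.eig, dotProduct_smul, smul_eq_mul]
  have e3 : u ⬝ᵥ (M *ᵥ w) = ε₁ * (w ⬝ᵥ u) := by
    rw [dotProduct_mulVec_comm_of_transpose_eq h.symm w u, e2]
  rw [e1, e2, e3, h.rayleigh_ground]
  ring

/-- **PROVED — alignment ⟸ variational ratio (GAP-CLASSES C1-N2).** For every unit `w`: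
`(1 − ⟨w,u⟩²)·(ε₂ − ε₁) ≤ wᵀMw − ε₁`, i.e. the squared-sine defect of `w` against the ground state is at most the M2 ratio
`(R(w) − ε₁)/(ε₂ − ε₁)`; equality iff the residual is a pure `ε₂`-mode. [folklore] -/
theorem defect_mul_gap_le (h : GroundGap M u ε₁ ε₂) {w : Fin n → ℝ} (hw : w ⬝ᵥ w = 1) :
    (1 - (w ⬝ᵥ u) ^ 2) * (ε₂ - ε₁) ≤ w ⬝ᵥ (M *ᵥ w) - ε₁ := by
  have hr := h.gap (w - (w ⬝ᵥ u) • u) (h.residual_dotProduct w)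
  rw [h.residual_normSq hw] at hr
  rw [h.rayleigh_eq w]
  nlinarith [hr]

/-- `⟨w,u⟩² ≤ 1` for unit `w` (the residual has non-negative norm). [folklore] -/
theorem sq_le_one (h : GroundGap M u ε₁ ε₂) {w : Fin n → ℝ} (hw : w ⬝ᵥ w = 1) : (w ⬝ᵥ u) ^ 2 ≤ 1 := by
  have h0 := dotProduct_self_nonneg_real (w - (w ⬝ᵥ u) • u)
  rw [h.residual_normSq hw] at h0
  linarith

/-- PROVED: the sign-blind defect `1 − |⟨w,u⟩|` of the tree (`alignDefect`) is at most the squared-sine defect, hence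
`alignDefect w u · (ε₂ − ε₁) ≤ wᵀMw − ε₁` — the harness reader's defect against the ground state is bounded by the M2
ratio. [folklore] -/
theorem alignDefect_mul_gap_le (h : GroundGap M u ε₁ ε₂) {w : Fin n → ℝ} (hw : w ⬝ᵥ w = 1) :
    alignDefect w u * (ε₂ - ε₁) ≤ w ⬝ᵥ (M *ᵥ w) - ε₁ := by
  have h1 := h.defect_mul_gap_le hw
  have habs : |w ⬝ᵥ u| ≤ 1 := (sq_le_one_iff_abs_le_one _).1 (h.sq_le_one hw)
  have h2 : alignDefect w u ≤ 1 - (w ⬝ᵥ u) ^ 2 := by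
    unfold alignDefect
    nlinarith [abs_nonneg (w ⬝ᵥ u), sq_abs (w ⬝ᵥ u)]
  have hgap : 0 ≤ ε₂ - ε₁ := by linarith [h.lt]
  calc alignDefect w u * (ε₂ - ε₁) ≤ (1 - (w ⬝ᵥ u) ^ 2) * (ε₂ - ε₁) :=
        mul_le_mul_of_nonneg_right h2 hgap
    _ ≤ w ⬝ᵥ (M *ᵥ w) - ε₁ := h1

/-! ## §2 The ground state is the strict Rayleigh minimiser off `±u` -/

/-- PROVED: `u` minimises the Rayleigh value over the unit sphere. [folklore] -/
theorem isGround (h : GroundGap M u ε₁ ε₂) :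
    ∀ v : Fin n → ℝ, v ⬝ᵥ v = 1 → u ⬝ᵥ (M *ᵥ u) ≤ v ⬝ᵥ (M *ᵥ v) := by
  intro v hv
  have h1 := h.defect_mul_gap_le hv
  have h2 : 0 ≤ (1 - (v ⬝ᵥ u) ^ 2) * (ε₂ - ε₁) :=
    mul_nonneg (by linarith [h.sq_le_one hv]) (by linarith [h.lt])
  rw [h.rayleigh_ground]
  linarith

/-- PROVED: strictly, for unit vectors with `⟨w,u⟩² < 1`. [folklore] -/
theorem rayleigh_gt (h : GroundGap M u ε₁ ε₂) {w : Fin n → ℝ} (hw : w ⬝ᵥ w = 1) (hc : (w ⬝ᵥ u) ^ 2 < 1) :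
    u ⬝ᵥ (M *ᵥ u) < w ⬝ᵥ (M *ᵥ w) := by
  have h1 := h.defect_mul_gap_le hw
  have h2 : 0 < (1 - (w ⬝ᵥ u) ^ 2) * (ε₂ - ε₁) := mul_pos (by linarith) (by linarith [h.lt])
  rw [h.rayleigh_ground]
  linarith

/-- PROVED: a unit vector with `⟨w,u⟩² = 1` is `±u` (`= ⟨w,u⟩ • u`). [folklore] -/
theorem eq_smul_of_sq_eq_one (h : GroundGap M u ε₁ ε₂) {w : Fin n → ℝ} (hw : w ⬝ᵥ w = 1)
    (hc : (w ⬝ᵥ u) ^ 2 = 1) : w = (w ⬝ᵥ u) • u := by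
  have hr : (w - (w ⬝ᵥ u) • u) ⬝ᵥ (w - (w ⬝ᵥ u) • u) = 0 := by rw [h.residual_normSq hw, hc, sub_self]
  exact sub_eq_zero.1 (dotProduct_self_eq_zero.1 hr)

end GroundGap

/-- PROVED (witness / the rank-one member of the aligned class): for a unit `u`, the matrix `−u uᵀ` (the window of
`negProjDatum`) has a ground gap with ground vector `u`, `ε₁ = −1`, `ε₂ = 0`. [folklore] -/
theorem groundGap_negVecMulVec {n : ℕ} {u : Fin n → ℝ} (hu : u ⬝ᵥ u = 1) :
    GroundGap (-vecMulVec u u) u (-1) 0 where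
  symm := by
    ext i j
    simp [vecMulVec_apply, mul_comm]
  unit := hu
  eig := by
    have h1 : vecMulVec u u *ᵥ u = (u ⬝ᵥ u) • u := by
      ext i
      simp [Matrix.mulVec, dotProduct, vecMulVec_apply, Finset.mul_sum, mul_comm, mul_left_comm]
    rw [Matrix.neg_mulVec, h1, hu, one_smul, neg_one_smul]
  gap := by
    intro w hw
    rw [zero_mul, Matrix.neg_mulVec, dotProduct_neg, dotProduct_vecMulVec_mulVec, hw, mul_zero, neg_zero]
  lt := by norm_num

/-- the sign-blind defect is invariant under `w ↦ c • w` with `c² = 1`. [folklore] -/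
theorem alignDefect_smul_of_sq_eq_one {n : ℕ} {c : ℝ} (hc : c ^ 2 = 1) (u g : Fin n → ℝ) :
    alignDefect (c • u) g = alignDefect u g := by
  have habs : |c| = 1 := (pow_eq_one_iff_of_nonneg (abs_nonneg c) two_ne_zero).1 (by rw [sq_abs]; exact hc)
  unfold alignDefect
  rw [smul_dotProduct, smul_eq_mul, abs_mul, habs, one_mul]

/-! ## §3 READER = CLASS under a ground gap -/

namespace GroundGap

variable {n : ℕ} {M : Matrix (Fin n) (Fin n) ℝ} {u : Fin n → ℝ} {ε₁ ε₂ : ℝ}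

/-- PROVED: under a ground gap, if the ground vector's defect against `g` is `< δ₀` then the window is `δ₀`-aligned
(every `δ₀`-misaligned unit vector differs from `±u`, hence is strictly beaten by `u`). [folklore] -/
theorem windowAligned_of_alignDefect_lt (h : GroundGap M u ε₁ ε₂) {g : Fin n → ℝ} {δ₀ : ℝ}
    (hd : alignDefect u g < δ₀) : WindowAligned g δ₀ M := by
  intro w hw hδ
  refine ⟨u, h.unit, h.rayleigh_gt hw ?_⟩
  rcases (h.sq_le_one hw).lt_or_eq with hlt | heq
  · exact hlt
  · exfalso
    have hw' : w = (w ⬝ᵥ u) • u := h.eq_smul_of_sq_eq_one hw heq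
    have hdef : alignDefect w g = alignDefect u g := by
      rw [hw']
      exact alignDefect_smul_of_sq_eq_one heq u g
    linarith [hδ]

/-- **PROVED — READER = CLASS.** Under a ground gap, `M` is `δ₀`-aligned with `g` iff the ground vector's sign-blind
defect is `< δ₀` — the eigenvector-free class condition of `PfPersistenceAlignedClass` IS the harness reader's verdict
on the served ground vector. [folklore] -/
theorem windowAligned_iff (h : GroundGap M u ε₁ ε₂) {g : Fin n → ℝ} {δ₀ : ℝ} :
    WindowAligned g δ₀ M ↔ alignDefect u g < δ₀ :=
  ⟨fun hW => hW.alignDefect_lt h.unit h.isGround, h.windowAligned_of_alignDefect_lt⟩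

end GroundGap

/-- a GROUND FAMILY on the regime `R` for the datum `d`: a served ground vector and the two bottom levels, window by
window (intended instance: the atlas fields `u_even`, `eigs_even[0..1]` — DATA, never constructed here). [folklore] -/
def HasGroundGapOn (R : Set Window) (d : Datum) (u : GuessFamily) (ε₁ ε₂ : Window → ℝ) : Prop :=
  ∀ win ∈ R, GroundGap (d win) (u win) (ε₁ win) (ε₂ win)

/-- PROVED (witness): the rank-one datum `negProjDatum g` of `PfPersistenceAlignedClass` has a ground gap on every
regime, with ground family `g` itself. [folklore] -/
theorem hasGroundGapOn_negProjDatum (R : Set Window) {g : GuessFamily} (hg : ∀ win, g win ⬝ᵥ g win = 1) :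
    HasGroundGapOn R (negProjDatum g) g (fun _ => -1) (fun _ => 0) :=
  fun win _ => groundGap_negVecMulVec (hg win)

/-- **PROVED — the aligned class read off the served ground vectors.** For a datum with a ground gap at every window of
the regime, membership in `alignedClassOn R g δ₀` is exactly 'defect of the ground vector against the guess `< δ₀` at
every window of `R`' — what GUESS-ALIGN evaluates. [folklore] -/
theorem mem_alignedClassOn_iff_of_groundGap {R : Set Window} {d : Datum} {u : GuessFamily} {ε₁ ε₂ : Window → ℝ}
    (h : HasGroundGapOn R d u ε₁ ε₂) (g : GuessFamily) (δ₀ : ℝ) :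
    d ∈ alignedClassOn R g δ₀ ↔ ∀ win ∈ R, alignDefect (u win) (g win) < δ₀ := by
  simp only [alignedClassOn, Set.mem_setOf_eq]
  exact ⟨fun hd win hwin => ((h win hwin).windowAligned_iff).1 (hd win hwin),
    fun hd win hwin => ((h win hwin).windowAligned_iff).2 (hd win hwin)⟩

/-- PROVED (M2 bound for the reader, datum level): with a ground gap on `R`, at every window of `R` the reader's defect of
the ground vector against ANY unit guess is at most the guess's M2 ratio: `alignDefect (u win) (g win) · (ε₂ − ε₁) ≤
R(g win) − ε₁`. [folklore] -/
theorem alignDefect_ground_le_of_groundGap {R : Set Window} {d : Datum} {u : GuessFamily} {ε₁ ε₂ : Window → ℝ}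
    (h : HasGroundGapOn R d u ε₁ ε₂) {g : GuessFamily} (hg : ∀ win, g win ⬝ᵥ g win = 1) {win : Window}
    (hwin : win ∈ R) :
    alignDefect (u win) (g win) * (ε₂ win - ε₁ win) ≤ g win ⬝ᵥ (d win *ᵥ g win) - ε₁ win := by
  have h1 := (h win hwin).alignDefect_mul_gap_le (hg win)
  have hsymm : alignDefect (u win) (g win) = alignDefect (g win) (u win) := by
    unfold alignDefect
    rw [dotProduct_comm]
  rw [hsymm]
  exact h1

end Summit.RiemannHypothesis.RiemannHypothesis.Theorems.PfPersistence
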